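import Summits.QuantumFields.YangMills.Theorems.TwistedTraceScaling.Negative.OrthoTubePolarFrame
import HarnessLib

/-!
# R30 — the transversality hypothesis of the exact framed product form (R28) is NECESSARY: with AXIAL stiff components even the half-angle frame — indeed every frame fixing axial
# data — admits no product form `F(φ, φ'; |v|², |v'|²) + G(ρ_φ v, ρ_φ' v')` on the abelian slow path
# (crux disprover of `TwistedTraceScaling`, stmt-QuantumFields-20203, cycle 23; `--supports` the crux; negative lane, def-free)

R28 (`Negative/OrthoTubePolarFrame.lean`) showed: on the abelian slow path `w_φ = (diagSU2 φ, 1, 1)` with AXIS-TRANSVERSE capped balanced stiff data the time coupling of the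
orthographic tube IS a product form in the HALF-ANGLE frame `r_φ = (diagSU2(−φ/2), 1, 1)` (`timeCoupling_abelian_transverse`), and that frozen / adjoint-class frames fail there.
THIS FILE removes the transversality hypothesis and shows the exactness dies:
* ★ `scalarPart_link_axial`: for AXIAL stiff data `x = s e₀`, `y = t e₀` the slow step through the pair is `cos ψ·(√(1−s²)√(1−t²) + st) + sin ψ·(√(1−s²)t − √(1−t²)s)` — the even
  axial term `cos ψ·st` and the odd term `sin ψ(αt − α's)` of `R28.scalarPart_chart_diagSU2_chart_inv`, untouched by any rotation about the slow axis;
* ★★ `axial_witness`: two capped balanced AXIAL configurations `v⁺ = (ε e₀, −ε e₀, 0, …)`, `v⁻ = −v⁺` (equal amplitude profiles) with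
  `tc(Ψ(w_φ,v⁺),Ψ(1,v⁺)) − tc(Ψ(w_φ,v⁺),Ψ(1,v⁻)) = 8ε²·cos φ` (the odd terms cancel by balance, the even axial term survives);
* ★★★ `not_separable_of_frames_fix_axial`: for ANY family of fibre maps `ρ_φ` fixing axial data (every rotation about the slow axis does) there are no `F, G` — with `F` allowed to
  depend on the slow angles `φ, φ'` ARBITRARILY and on the amplitude profiles — such that `tc(Ψ(w_φ,v),Ψ(w_φ',v')) = F(φ,φ'; |v|², |v'|²) + G(ρ_φ v, ρ_φ' v')` for all capped balanced
  `v, v'` (`L ≥ 2`): `G(v⁺,v⁺) − G(v⁺,v⁻)` would have to be `8ε²` (`φ = 0`) and `0` (`φ = π/2`);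
* ★★★ `not_separable_halfAngleFrame`: in particular for the half-angle frame `colourRotate r_φ` itself (`halfAngleFrame_fixes_axial`) — so the hypothesis «`v_e·e₀ = 0` on the
  turning direction» of R28's exact product form cannot be dropped: the axial components of the stiff data couple to the slow angle through `cos ψ·x₀y₀` at SECOND order in the
  stiff amplitude, exactly like the transverse ones, but with the slow factor `cos ψ` instead of a frame rotation — a product kernel must treat the axial stiff components as part
  of the SLOW factor's profile data (`|v|²` is not enough: the sign of `x₀y₀` matters), or budget the term (`β·ε²·ψ²`-type, second order in the slow displacement: harmless on the
  kinetic core, cf. R26 §3).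
HONEST FRAMING: quaternion algebra on a fixed lattice for a stub (S-BASE, C4-CORE chart) of a child of the CONDITIONAL reduction route R2b1 (femto rung); no kernel estimate
refuted or proved; C4 OPEN; not infinite volume, not a gap, not Clay.

## References
* M. Lüscher, Some analytic results concerning the mass spectrum of Yang–Mills gauge theories on a torus, Nucl. Phys. B219 (1983) 233–261, §3. [Luscher1983]
* T. Bröcker, T. tom Dieck, *Representations of Compact Lie Groups*, Springer GTM 98 (1985), I (1.10). [BrockerTomDieck1985]
-/

set_option autoImplicit false

noncomputable section

open Finset Real
open scoped BigOperators Matrix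
open Literature.MathematicalPhysics.QuantumFieldTheory hiding SU2
open Literature.MathematicalPhysics.QuantumLattice

namespace Summit.QuantumFields.YangMills.Theorems.TwistedTraceScaling.Negative.R30

open Summit.QuantumFields.YangMills.Theorems.FemtoTransferGap Summit.QuantumFields.YangMills.Theorems.FemtoTransferGap.TwoLattice
open Summit.QuantumFields.YangMills.Theorems.FemtoTransferGap.TwoLattice.Toron Summit.QuantumFields.YangMills.Theorems.FemtoTransferGap.TwoLattice.Flat
open Summit.QuantumFields.YangMills.Theorems.FemtoTransferGap.TwoLattice.Cov Summit.QuantumFields.YangMills.Theorems.FemtoTransferGap.TwoLattice.ConstTube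
open Summit.QuantumFields.YangMills.Theorems.TwistedTraceScaling.Negative.R26
open Summit.QuantumFields.YangMills.Theorems.TwistedTraceScaling.Negative.R28

variable {L : ℕ} [NeZero L]

/-! ## §1 Per-link algebra for axial stiff data -/

omit [NeZero L] in
/-- `t·e₀ = (t, 0, 0)`. [folklore] -/
theorem single_zero_eq (t : ℝ) : (Pi.single 0 t : Fin 3 → ℝ) = ![t, 0, 0] := by
  funext a; fin_cases a <;> simp

omit [NeZero L] in
/-- Rotations about the slow axis fix axial vectors. [folklore] -/
theorem chargedRot_mulVec_single_zero (θ t : ℝ) : chargedRot θ *ᵥ (Pi.single 0 t : Fin 3 → ℝ) = Pi.single 0 t := by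
  rw [single_zero_eq]
  funext a
  fin_cases a <;> simp [chargedRot, Matrix.mulVec, dotProduct, Fin.sum_univ_three]

omit [NeZero L] in
/-- ★ **The slow step through an AXIAL stiff pair**: `(W(s e₀)·diagSU2 ψ·W(t e₀)⁻¹)₀ = cos ψ·(√(1−s²)√(1−t²) + st) + sin ψ·(√(1−s²)t − √(1−t²)s)`. [cite: BrockerTomDieck1985, I (1.10)] -/
theorem scalarPart_link_axial {s t : ℝ} (hs : s ^ 2 ≤ 1) (ht : t ^ 2 ≤ 1) (ψ : ℝ) :
    scalarPart (chartSU2 (Pi.single 0 s) * diagSU2 ψ * (chartSU2 (Pi.single 0 t))⁻¹) =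
      Real.cos ψ * (√(1 - s ^ 2) * √(1 - t ^ 2) + s * t) + Real.sin ψ * (√(1 - s ^ 2) * t - √(1 - t ^ 2) * s) := by
  have h1 : ∑ a, (Pi.single 0 s : Fin 3 → ℝ) a ^ 2 ≤ 1 := by rw [sum_single_sq]; exact hs
  have h2 : ∑ a, (Pi.single 0 t : Fin 3 → ℝ) a ^ 2 ≤ 1 := by rw [sum_single_sq]; exact ht
  rw [scalarPart_chart_diagSU2_chart_inv h1 h2, sum_single_sq, sum_single_sq, chargedRot_mulVec_single_zero, dotProduct_single, Pi.single_eq_same,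
    Pi.single_eq_same]
  ring

omit [NeZero L] in
/-- Same axial data on both sides: a class function of the slow step, `cos ψ`. [folklore] -/
theorem scalarPart_link_axial_same {s : ℝ} (hs : s ^ 2 ≤ 1) (ψ : ℝ) :
    scalarPart (chartSU2 (Pi.single 0 s) * diagSU2 ψ * (chartSU2 (Pi.single 0 s))⁻¹) = Real.cos ψ := by
  have hα : √(1 - s ^ 2) * √(1 - s ^ 2) = 1 - s ^ 2 := Real.mul_self_sqrt (by nlinarith)
  rw [scalarPart_link_axial hs hs]
  linear_combination Real.cos ψ * hα

omit [NeZero L] in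
/-- Opposite axial data: `cos ψ·(1 − 2s²) − 2s√(1−s²)·sin ψ`. [folklore] -/
theorem scalarPart_link_axial_opp {s : ℝ} (hs : s ^ 2 ≤ 1) (ψ : ℝ) :
    scalarPart (chartSU2 (Pi.single 0 s) * diagSU2 ψ * (chartSU2 (Pi.single 0 (-s)))⁻¹) =
      Real.cos ψ * (1 - 2 * s ^ 2) - 2 * (s * √(1 - s ^ 2)) * Real.sin ψ := by
  have hs' : (-s) ^ 2 ≤ 1 := by rwa [neg_sq]
  have hα : √(1 - s ^ 2) * √(1 - s ^ 2) = 1 - s ^ 2 := Real.mul_self_sqrt (by nlinarith)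
  rw [scalarPart_link_axial hs hs', neg_sq]
  linear_combination Real.cos ψ * hα

omit [NeZero L] in
/-- Opposite axial data, mirrored: `cos ψ·(1 − 2s²) + 2s√(1−s²)·sin ψ`. [folklore] -/
theorem scalarPart_link_axial_opp' {s : ℝ} (hs : s ^ 2 ≤ 1) (ψ : ℝ) :
    scalarPart (chartSU2 (Pi.single 0 (-s)) * diagSU2 ψ * (chartSU2 (Pi.single 0 s))⁻¹) =
      Real.cos ψ * (1 - 2 * s ^ 2) + 2 * (s * √(1 - s ^ 2)) * Real.sin ψ := by
  have hs' : (-s) ^ 2 ≤ 1 := by rwa [neg_sq]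
  have hα : √(1 - s ^ 2) * √(1 - s ^ 2) = 1 - s ^ 2 := Real.mul_self_sqrt (by nlinarith)
  rw [scalarPart_link_axial hs' hs, neg_sq]
  linear_combination Real.cos ψ * hα

/-- Capped balanced data are closed under `v ↦ −v`. [folklore] -/
theorem neg_mem_capBalancedSet {v : Edge 3 L → Fin 3 → ℝ} (hv : v ∈ capBalancedSet L) : (fun e => -v e) ∈ capBalancedSet L := by
  refine ⟨(mem_balancedSet L _).2 fun k a => ?_, fun e => ?_⟩
  · have h := (mem_balancedSet L _).1 hv.1 k a
    simp only [Pi.neg_apply, Finset.sum_neg_distrib, h, neg_zero]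
  · simp only [Pi.neg_apply, neg_sq]
    exact hv.2 e

/-! ## §2 ★★ The axial witness: the even axial term survives balance -/

/-- ★★ **AXIAL WITNESS.**  For `L ≥ 2` and `ε² ≤ 1/4` there are capped balanced AXIAL configurations `v⁺` (amplitude `±ε e₀` at two direction-`0` links, `0` elsewhere) and `v⁻ = −v⁺`
(equal amplitude profiles) with `tc(Ψ(w_φ,v⁺),Ψ(1,v⁺)) − tc(Ψ(w_φ,v⁺),Ψ(1,v⁻)) = 8ε²·cos φ` for every slow angle `φ`. [cite: Luscher1983, §3] -/
theorem axial_witness (hL : 2 ≤ L) {ε : ℝ} (hε : ε ^ 2 ≤ 1 / 4) :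
    ∃ vP vN : Edge 3 L → Fin 3 → ℝ, vP ∈ capBalancedSet L ∧ vN ∈ capBalancedSet L ∧ (fun e => ∑ a, vN e a ^ 2) = (fun e => ∑ a, vP e a ^ 2) ∧
      (∀ e : Edge 3 L, vP e 1 = 0 ∧ vP e 2 = 0) ∧ (∀ e : Edge 3 L, vN e 1 = 0 ∧ vN e 2 = 0) ∧
      ∀ φ : ℝ, timeCoupling su2Rep (orthoTube L (fun e => if e.2 = 0 then diagSU2 φ else 1) vP) (orthoTube L 1 vP) -
          timeCoupling su2Rep (orthoTube L (fun e => if e.2 = 0 then diagSU2 φ else 1) vP) (orthoTube L 1 vN) =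
        8 * ε ^ 2 * Real.cos φ := by
  haveI : Fact (1 < L) := ⟨hL⟩
  have hne : (((0 : Site 3 L), (0 : Fin 3)) : Edge 3 L) ≠ ((Pi.single 0 1 : Site 3 L), (0 : Fin 3)) := fun h => by
    simpa using congrFun (congrArg Prod.fst h) 0
  set e₀ : Edge 3 L := ((0 : Site 3 L), (0 : Fin 3)) with he₀
  set e₁ : Edge 3 L := ((Pi.single 0 1 : Site 3 L), (0 : Fin 3)) with he₁
  set amp : Edge 3 L → ℝ := fun e => if e = e₀ then ε else if e = e₁ then -ε else 0 with hamp
  have amp0 : amp e₀ = ε := by simp [hamp]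
  have amp1 : amp e₁ = -ε := by simp [hamp, hne.symm]
  have ampo : ∀ e, e ≠ e₀ → e ≠ e₁ → amp e = 0 := fun e h0 h1 => by simp [hamp, h0, h1]
  have ampsq : ∀ e, amp e ^ 2 ≤ ε ^ 2 := fun e => by
    by_cases h0 : e = e₀
    · rw [h0, amp0]
    · by_cases h1 : e = e₁
      · rw [h1, amp1, neg_sq]
      · rw [ampo e h0 h1, zero_pow two_ne_zero]; exact sq_nonneg ε
  have ampbal : ∀ k : Fin 3, ∑ x : Site 3 L, amp (x, k) = 0 := fun k => by
    by_cases hk : k = 0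
    · subst hk
      rw [Fintype.sum_eq_add (0 : Site 3 L) (Pi.single 0 1 : Site 3 L) (fun h => hne (congrArg (fun x => (x, (0 : Fin 3))) h)) fun x hx =>
          ampo _ (fun h => hx.1 (congrArg Prod.fst h)) (fun h => hx.2 (congrArg Prod.fst h)), amp0, amp1, add_neg_cancel]
    · exact Finset.sum_eq_zero fun x _ => ampo _ (fun h => hk (congrArg Prod.snd h)) (fun h => hk (congrArg Prod.snd h))
  have mem : (fun e => (Pi.single 0 (amp e) : Fin 3 → ℝ)) ∈ capBalancedSet L := by
    refine ⟨(mem_balancedSet L _).2 fun k a => ?_, fun e => ?_⟩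
    · by_cases ha : a = 0
      · subst ha; simp only [Pi.single_eq_same]; exact ampbal k
      · simp [Pi.single_eq_of_ne ha]
    · show ∑ a, (Pi.single 0 (amp e) : Fin 3 → ℝ) a ^ 2 ≤ 1 / 4
      rw [sum_single_sq]; exact (ampsq e).trans hε
  have memN : (fun e => (Pi.single 0 (-amp e) : Fin 3 → ℝ)) ∈ capBalancedSet L := by
    have h := neg_mem_capBalancedSet mem
    refine (congrArg (· ∈ capBalancedSet L) ?_).mp h
    funext e; rw [Pi.single_neg]
  have hε1 : ε ^ 2 ≤ 1 := hε.trans (by norm_num)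
  have hε1' : (-ε) ^ 2 ≤ 1 := by rwa [neg_sq]
  obtain ⟨k0, k1⟩ : e₀.2 = 0 ∧ e₁.2 = 0 := ⟨rfl, rfl⟩
  have hΔ : ∀ φ : ℝ, timeCoupling su2Rep (orthoTube L (fun e => if e.2 = 0 then diagSU2 φ else 1) fun e => Pi.single 0 (amp e))
        (orthoTube L 1 fun e => Pi.single 0 (amp e)) -
      timeCoupling su2Rep (orthoTube L (fun e => if e.2 = 0 then diagSU2 φ else 1) fun e => Pi.single 0 (amp e))
        (orthoTube L 1 fun e => Pi.single 0 (-amp e)) = 8 * ε ^ 2 * Real.cos φ := fun φ => by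
    unfold timeCoupling
    rw [← Finset.sum_sub_distrib, Fintype.sum_eq_add e₀ e₁ hne ?_]
    · simp only [orthoTube_apply, TubeMax.re_trace_su2Rep, Pi.one_apply, mul_one, k0, k1, if_true, amp0, amp1, neg_neg,
        scalarPart_link_axial_same hε1, scalarPart_link_axial_same hε1', scalarPart_link_axial_opp hε1, scalarPart_link_axial_opp' hε1]
      ring
    · rintro e ⟨h0, h1⟩
      simp only [orthoTube_apply, ampo e h0 h1, neg_zero, sub_self]
  refine ⟨fun e => Pi.single 0 (amp e), fun e => Pi.single 0 (-amp e), mem, memN, ?_, fun e => ⟨by simp, by simp⟩, fun e => ⟨by simp, by simp⟩, hΔ⟩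
  funext e; simp only [sum_single_sq, neg_sq]

/-! ## §3 ★★★ No product form once axial stiff data are allowed — for every frame fixing axial data, in particular the half-angle frame -/

/-- ★★★ **NON-SEPARABILITY WITH AXIAL DATA, ANY AXIAL-FIXING FRAME.**  Let `ρ_φ` be any family of self-maps of the stiff fibre fixing the axial configurations (`v_e ∥ e₀` for all
`e`).  Then there are no `F, G` — `F` may depend on the slow angles `φ, φ'` arbitrarily and on the amplitude profiles — with
`tc(Ψ(w_φ,v),Ψ(w_φ',v')) = F(φ, φ'; (|v_e|²)_e, (|v'_e|²)_e) + G(ρ_φ v, ρ_φ' v')` for all capped balanced `v, v'` (`L ≥ 2`). [cite: Luscher1983, §3] -/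
theorem not_separable_of_frames_fix_axial (hL : 2 ≤ L) (ρ : ℝ → (Edge 3 L → Fin 3 → ℝ) → (Edge 3 L → Fin 3 → ℝ))
    (hρ : ∀ (φ : ℝ) (v : Edge 3 L → Fin 3 → ℝ), (∀ e : Edge 3 L, v e 1 = 0 ∧ v e 2 = 0) → ρ φ v = v) :
    ¬ ∃ (F : ℝ → ℝ → (Edge 3 L → ℝ) → (Edge 3 L → ℝ) → ℝ) (G : (Edge 3 L → Fin 3 → ℝ) → (Edge 3 L → Fin 3 → ℝ) → ℝ),
        ∀ (φ φ' : ℝ) (v v' : Edge 3 L → Fin 3 → ℝ), v ∈ capBalancedSet L → v' ∈ capBalancedSet L →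
          timeCoupling su2Rep (orthoTube L (fun e => if e.2 = 0 then diagSU2 φ else 1) v) (orthoTube L (fun e => if e.2 = 0 then diagSU2 φ' else 1) v') =
            F φ φ' (fun e => ∑ a, v e a ^ 2) (fun e => ∑ a, v' e a ^ 2) + G (ρ φ v) (ρ φ' v') := by
  rintro ⟨F, G, H⟩
  obtain ⟨vP, vN, hP, hN, hprof, haxP, haxN, hΔ⟩ := axial_witness hL (by norm_num : (1 / 2 : ℝ) ^ 2 ≤ 1 / 4)
  have key : ∀ φ : ℝ, 8 * (1 / 2 : ℝ) ^ 2 * Real.cos φ = G vP vP - G vP vN := fun φ => by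
    rw [← hΔ φ]
    have h1 := H φ 0 vP vP hP hP
    have h2 := H φ 0 vP vN hP hN
    rw [path_zero] at h1 h2
    rw [h1, h2, hρ φ vP haxP, hρ 0 vP haxP, hρ 0 vN haxN, hprof]
    ring
  have h0 := key 0
  have hπ := key (π / 2)
  rw [Real.cos_zero] at h0
  rw [Real.cos_pi_div_two] at hπ
  linarith

omit [NeZero L] in
/-- The half-angle colour frame fixes axial data. [folklore] -/
theorem halfAngleFrame_fixes_axial (φ : ℝ) (v : Edge 3 L → Fin 3 → ℝ) (hv : ∀ e : Edge 3 L, v e 1 = 0 ∧ v e 2 = 0) :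
    colourRotate L (fun k => if k = 0 then diagSU2 (-(φ / 2)) else 1) v = v := by
  funext e
  rw [colourRotate_halfAngle_apply]
  by_cases hk : e.2 = 0
  · rw [if_pos hk]
    have hve : v e = Pi.single 0 (v e 0) := by
      funext a
      fin_cases a
      · simp
      · simp [(hv e).1]
      · simp [(hv e).2]
    rw [hve, chargedRot_mulVec_single_zero]
  · rw [if_neg hk]

/-- ★★★ **THE TRANSVERSALITY HYPOTHESIS OF R28's EXACT FRAMED PRODUCT FORM IS NECESSARY**: with the half-angle frame `colourRotate (diagSU2(−φ/2), 1, 1)` itself there are no `F, G`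
with `tc(Ψ(w_φ,v),Ψ(w_φ',v')) = F(φ, φ'; |v|², |v'|²) + G(colourRotate r_φ v, colourRotate r_φ' v')` for ALL capped balanced `v, v'` (axial components allowed), `L ≥ 2` — contrast
`R28.timeCoupling_abelian_transverse` (exact when `v_e·e₀ = 0 = v'_e·e₀` on direction `0`). [cite: Luscher1983, §3] -/
theorem not_separable_halfAngleFrame (hL : 2 ≤ L) :
    ¬ ∃ (F : ℝ → ℝ → (Edge 3 L → ℝ) → (Edge 3 L → ℝ) → ℝ) (G : (Edge 3 L → Fin 3 → ℝ) → (Edge 3 L → Fin 3 → ℝ) → ℝ),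
        ∀ (φ φ' : ℝ) (v v' : Edge 3 L → Fin 3 → ℝ), v ∈ capBalancedSet L → v' ∈ capBalancedSet L →
          timeCoupling su2Rep (orthoTube L (fun e => if e.2 = 0 then diagSU2 φ else 1) v) (orthoTube L (fun e => if e.2 = 0 then diagSU2 φ' else 1) v') =
            F φ φ' (fun e => ∑ a, v e a ^ 2) (fun e => ∑ a, v' e a ^ 2) +
              G (colourRotate L (fun k => if k = 0 then diagSU2 (-(φ / 2)) else 1) v) (colourRotate L (fun k => if k = 0 then diagSU2 (-(φ' / 2)) else 1) v') :=
  not_separable_of_frames_fix_axial hL (fun φ => colourRotate L fun k => if k = 0 then diagSU2 (-(φ / 2)) else 1) halfAngleFrame_fixes_axial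

/-- ★★ And with no frame at all (`ρ = id`): the abelian family with axial data already refutes `F(φ, φ'; |v|², |v'|²) + G(v, v')` (R26's statement restricted to the abelian
slow path, with `F` free in the angles). [cite: Luscher1983, §3] -/
theorem not_separable_unframed_axial (hL : 2 ≤ L) :
    ¬ ∃ (F : ℝ → ℝ → (Edge 3 L → ℝ) → (Edge 3 L → ℝ) → ℝ) (G : (Edge 3 L → Fin 3 → ℝ) → (Edge 3 L → Fin 3 → ℝ) → ℝ),
        ∀ (φ φ' : ℝ) (v v' : Edge 3 L → Fin 3 → ℝ), v ∈ capBalancedSet L → v' ∈ capBalancedSet L →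
          timeCoupling su2Rep (orthoTube L (fun e => if e.2 = 0 then diagSU2 φ else 1) v) (orthoTube L (fun e => if e.2 = 0 then diagSU2 φ' else 1) v') =
            F φ φ' (fun e => ∑ a, v e a ^ 2) (fun e => ∑ a, v' e a ^ 2) + G v v' :=
  not_separable_of_frames_fix_axial hL (fun _ v => v) fun _ _ _ => rfl

end Summit.QuantumFields.YangMills.Theorems.TwistedTraceScaling.Negative.R30

end
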